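/-
Copyright: lit-balaban cell, Phase-2 proof seat p33 (gen 7).  Statement-level skeleton of a published paper; no proof claims beyond
what the kernel checks below.
-/
import Literature.MathematicalPhysics.QuantumFieldTheory.BalabanImbrieJaffe1984to88.BIJ85Rem317AnyField
import Literature.MathematicalPhysics.QuantumFieldTheory.BalabanImbrieJaffe1984to88.BIJ85Sigma422Eta
import Literature.MathematicalPhysics.QuantumFieldTheory.BalabanImbrieJaffe1984to88.BIJ88Sect3Rescaling
import Literature.MathematicalPhysics.QuantumFieldTheory.BalabanImbrieJaffe1984to88.BIJ85AbelianStokes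

/-!
# `BalabanImbrieJaffe1984to88.BIJ85Eq454PlaqResidual` — T. Bałaban, J. Imbrie, A. Jaffe, *Renormalization of the Higgs model:
minimizers, propagators and the stability of mean field theory*, Commun. Math. Phys. **97** (1985) 299–329
[BalabanImbrieJaffe1985]: **the plaquette variables of the ACTUAL background field (4.5.4)** `u_k = Q^{s*}_kv·exp[−ie_kη(𝒟_k∂^*Q^{e*}_kf^{(k)})]`
ON THE TORI, with the operators OF RECORD (p11's `𝒟_k = BIJ85Prop522Torus.DkE`, p09's `∂^* = (curlOp)†`, p30's `Q^{e*}_k = QesOp`,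
weight `w = η^d`, lattice factor `c = η⁻¹`, `η = L^{−k}`): by Remark 2 p. 317 and (5.2.10),
**`u_k(∂p) = exp(ie_kη²f_k(p))` EXACTLY, `f_k = (I − ∂G_{k,Ax}∂^*)Q^{e*}_kf^{(k)}` the field (4.2.6)**, hence
`L^{2k}|u_k(∂p) − 1| ≤ e_k|f_k(p)|` for every η-plaquette `p` and every orientation — the gauge-INVARIANT smallness of `u_k` through which
the Sect. 7.3 stability estimate (7.3.2) is reached (seat p11's `BIJ85Ineq732General`), replacing the bondwise sup-norm of the smoothing
potential `𝒟_k∂^*Q^{e*}_kf^{(k)}` (which carries the Aharonov–Bohm `1/dist` growth around the edge plaquettes and is not small).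
File A of this seat's gen-7 member of SKELETON row **C1.Eq7.3.1-7.3.2** (owner r15, referee ref-5); files B `BIJ85Claim73Residual`, C
`BIJ85Claim73ActualOne`.

statement-level skeleton of published theorems with citation tags; proofs where landed; nothing here is a claim about the Yang–Mills mass gap

PDF held: `paper:balaban1985-cmp97-bij-higgs-minimizers` (journal page = PDF page + 298).  Pages read this session (`lit read`, OCR
text): p. 311 [PDF 13] ((4.2.6)–(4.2.7)), p. 313 [PDF 15] ((4.5.4)), p. 317 [PDF 19] (Remark 2, (5.2.10)–(5.2.12)), p. 326 [PDF 28]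
((7.3.1)–(7.3.2) and the closing paragraph *"by change of gauge u_k can be transformed in a local region Λ into a configuration of the
form exp[ie_kηA], where A is smooth and small"*).

CITATION HEADER (lean-in-tree rule).  Phase-2 file of the lit-balaban TYPED SKELETON (HOME `run/shared/lean/pub/lit-balaban/`), seat p33
gen 7 (unit `lit-balaban-p33-g7`; TAKING line HOME/STATUS.md 2026-08-21T18:54:37Z).  Objects BY NAME, nothing re-declared: p30's
(4.5.4) background form `qsU1Iter k v * expField (e_kη) (−X)` and dictionary `BIJ85Rem317AnyField.background_group_eq_background`, p31's
holonomy of (4.5.4) `BIJ85Eq454HolonomyBase0.plaq_background531_eq_exp`, p30's (5.2.10)/(4.2.7) on the tori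
`BIJ85Rem317Torus.curlG_torus_eq_DkE`/`eq427_torus`, p09's projection `BIJ85SigmaForm421.curlG`, p34's carrier dictionary
`BIJ88Sect3Rescaling.fieldEquiv`/`cfg_fieldEquiv`, r18's `BIJ88Sect3ModelBridge.plaqVar_coe`, p11's oriented plaquette variable
`BIJ85AbelianStokes.plaqC`/`norm_plaqC_sub_one_le_of_plaqHol`.  Definitions with bodies (no `def … : Prop`, no named fact; D-0026):
`resE` (the (4.2.6) field in the Euclidean encoding), `smoothX` (the η-bond field `𝒟_k∂^*Q^{e*}_kf^{(k)}` of record), `actualBg` (the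
background (4.5.4) COMPUTED FROM `v`), `actualBgU1` (the same read on the `U1`-valued carrier of the Sect. 4.6/7.3 scalar-field files).

THE PRINTED TEXT, verbatim.  p. 313 [PDF 15]: *"(u_k)_b = (Q^{s*}_kv)_b exp[−ie_kη(𝒟_k∂^*Q^{e*}_kf^{(k)})_b]. (4.5.4)"*; p. 311 [PDF 13]:
*"f_k ≡ (I − ∂G_{k,Ax}∂^*)Q^{e*}_kf, (4.2.6) we have ⟨f, σ_kf⟩ = ‖f_k‖²_η … (4.2.7)"*; p. 317 [PDF 19]: *"Remark 2. … f_k(p) =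
(ie_kη²)^{−1} ln u_k(∂p). (5.2.12) This follows from the definition (4.5.4) of u_k, giving u_k(∂p) = exp[ie_kη²Q^{e*}_kf^{(k)} −
ie_kη²∂𝒟_k∂^*Q^{e*}_kf^{(k)}]. From this and (5.2.10) we get (ie_kη²)^{−1} ln u_k(∂p) = Q^{e*}_kf^{(k)} − ∂G_{k,Ax}∂^*Q^{e*}_kf^{(k)},
coinciding with (4.2.6)."*

WHAT IS PROVED (0 `sorry`, standard axioms).
* §1 `resE hd w c k F := Q^{e*}_kF − ∂G_{k,Ax}∂^*Q^{e*}_kF` (p30's `QesOp`, p09's `curlG`) — (4.2.6) in the Euclidean encoding (the η-plaquette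
  vector carries `√w`); `resE_eq_DkE` (= `Q^{e*}_kF − ∂𝒟_k∂^*Q^{e*}_kF`, (5.2.10)); `norm_resE_sq` (`‖f_k‖² = ⟨F, σ_kF⟩`, (4.2.7));
  `resE_apply` (componentwise: `√w·[(Q^{e*}_kf)(p) − (∂X)(p)]`).
* §2 `smoothX`, `actualBg` = (4.5.4) computed from `v` at base 0 (`η = L^{−k}`, `w = η^d`, `c = η⁻¹`); **`plaq_actualBg_eq_exp`** —
  Remark 2 for it: `u_k(∂p) = exp[ie_kη²((Q^{e*}_kf^{(k)})(p) − (∂X)(p))]`; **`plaq_actualBg_eq_exp_resE`** — `u_k(∂p) = exp(ie_kη²·f_k(p))`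
  with `f_k(p) = (√w)⁻¹·resE(p)`; **`norm_plaq_actualBg_sub_one_le`** — `|u_k(∂p) − 1| ≤ |e_k|η²·|f_k(p)|`.
* §3 `actualBgU1 := fieldEquiv (actualBg …)`; `toC_plaqHol_fieldEquiv`; **`norm_plaqC_actualBgU1_sub_one_le`** — for every site `x` and
  EVERY ordered pair of directions, `‖plaqC u_k x μ ν − 1‖ ≤ |e_k|η²(√w)⁻¹·S` whenever `|resE(p)| ≤ S` for all `p` (the hypothesis
  shape `hθ` of p11's `BIJ85Ineq732General.ineq732_general`), and `pow_mul_eta_sq` (`(L^k)²η² = 1`).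
HONEST SCOPE.  Identities and the triangle-type bound only; the SIZE of `f_k` (sup-norm boundedness of `(I − ∂G_{k,Ax}∂^*)Q^{e*}_k`, a
consequence of the gradient member of (7.2.2)) is NOT claimed here — it is the located input of file B and is PROVED at `k = 1` in file C.
Standing range `k ≤ m + K`, `2 ≤ d`, `e ≠ 0` where a logarithm is divided.
-/

open scoped BigOperators RealInnerProductSpace

namespace Literature.MathematicalPhysics.QuantumFieldTheory.BalabanImbrieJaffe1984to88.BIJ85Eq454PlaqResidual

open Literature.MathematicalPhysics.QuantumFieldTheory.Balaban1983to89
open LatticeFieldCalculus BIJ85Sect1Model BIJ85SmallFieldSplit64 BIJ85AxialPropagator411 BIJ85SigmaForm421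
  BIJ85Prop521Torus BIJ85Sigma421Torus BIJ85Prop522Torus BIJ85Eq531Inputs BIJ85Eq454HolonomyBase0 BIJ85Rem317Torus
  BIJ85Eq622Torus BIJ85Rem317AnyField
open BIJ85Sigma422Eta (eta_inv eta_pos)
open BIJ88Sect3Statements (U1 toC cfg plaqVar plaqVar_cfg norm_toC)
open BIJ88Sect3Rescaling (fieldEquiv cfg_fieldEquiv)
open BIJ88Sect3ModelBridge (plaqVar_coe)
open BIJ85AbelianStokes (plaqC norm_plaqC_sub_one_le_of_plaqHol)

noncomputable section

variable {P : Params}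

/-! ## §1 The field (4.2.6) in the Euclidean encoding -/

/-- **(4.2.6)** `f_k ≡ (I − ∂G_{k,Ax}∂^*)Q^{e*}_kF` as a vector of p09's η-plaquette space (`Q^{e*}_k = QesOp hd w k`, carrying `√w`;
`∂G_{k,Ax}∂^*` = p09's orthogonal projection `curlG (V411 P k) (curlOp w c)`), for a unit-lattice plaquette field `F`.
[cite: BalabanImbrieJaffe1985, (4.2.6) p.311] -/
def resE (hd : 2 ≤ P.d) (w c : ℝ) (k : ℕ) (F : UnitPlaqSpace P k) : PlaqSpace P :=
  QesOp (P := P) hd w k F - curlG (V411 P k) (curlOp (P := P) w c) (QesOp (P := P) hd w k F)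

/-- **(4.2.6) through (5.2.10)**: `f_k = Q^{e*}_kF − ∂𝒟_k∂^*Q^{e*}_kF` with `𝒟_k = DkE` ((4.4.4), Landau minimizers) — p30's `curlG_torus_eq_DkE`;
`k ≤ m + K`, `c ≠ 0`, `w > 0`. [cite: BalabanImbrieJaffe1985, (5.2.10) p.317] -/
theorem resE_eq_DkE (hd : 2 ≤ P.d) {k : ℕ} (hk : k ≤ P.m + P.K) {c : ℝ} (hc : c ≠ 0) {w : ℝ} (hw : 0 < w)
    (F : UnitPlaqSpace P k) :
    resE hd w c k F = QesOp (P := P) hd w k F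
      - curlOp (P := P) w c (DkE P w c k (LinearMap.adjoint (curlOp (P := P) w c) (QesOp (P := P) hd w k F))) := by
  rw [resE, curlG_torus_eq_DkE hk hc hw]
  rfl

/-- **(4.2.7)** `⟨F, σ_kF⟩ = ‖f_k‖²` for the torus σ_k of record (p30's `eq427_torus`); `k ≤ m + K`, `c ≠ 0`, `w > 0`, `2 ≤ d`.
[cite: BalabanImbrieJaffe1985, (4.2.7) p.311] -/
theorem norm_resE_sq (hd : 2 ≤ P.d) {k : ℕ} (hk : k ≤ P.m + P.K) {c : ℝ} (hc : c ≠ 0) {w : ℝ} (hw : 0 < w)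
    (F : UnitPlaqSpace P k) :
    ‖resE hd w c k F‖ ^ 2 = ⟪F, sigmaTorus (P := P) hd w c k F⟫ := by
  rw [resE, eq427_torus hd hk hc hw]

/-- componentwise: `f_k(p)·√w`, i.e. `resE(p) = √w·[(Q^{e*}_kf)(p) − (∂X)(p)]` with `X = 𝒟_k∂^*Q^{e*}_kF` read as an η-bond function and
`∂ = curl c` (`k ≤ m + K`, `c ≠ 0`, `w > 0`). [cite: BalabanImbrieJaffe1985, (5.2.12) p.317] -/
theorem resE_apply (hd : 2 ≤ P.d) {k : ℕ} (hk : k ≤ P.m + P.K) {c : ℝ} (hc : c ≠ 0) {w : ℝ} (hw : 0 < w)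
    (F : UnitPlaqSpace P k) (p : Balaban1983to89.Plaq P 0) :
    resE hd w c k F p = Real.sqrt w * (QestarIter hd k (fun q => F q) p
      - curl c (WithLp.ofLp (DkE P w c k (LinearMap.adjoint (curlOp (P := P) w c) (QesOp (P := P) hd w k F)))) p) := by
  rw [resE_eq_DkE hd hk hc hw, PiLp.sub_apply, QesOp_apply, mul_sub]
  rfl

/-! ## §2 The actual background (4.5.4) at base 0 and its plaquette variables -/

/-- kernel: `ηL^k = 1` for `η = L^{−k}` (`Params.eta`). [cite: BalabanImbrieJaffe1985, (2.1) p.302] -/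
theorem eta_mul_L_pow (P : Params) (k : ℕ) : P.eta k * (P.L : ℝ) ^ k = 1 := by
  rw [← eta_inv, mul_inv_cancel₀ (eta_pos P k).ne']

/-- kernel: `(L^k)²η² = 1`. [cite: BalabanImbrieJaffe1985, (2.1) p.302] -/
theorem pow_mul_eta_sq (P : Params) (k : ℕ) : ((P.L : ℝ) ^ k) ^ 2 * (P.eta k) ^ 2 = 1 := by
  rw [← mul_pow, mul_comm, eta_mul_L_pow, one_pow]

/-- **the smoothing field of (4.5.4)**, `X = 𝒟_k∂^*Q^{e*}_kf^{(k)}` with the operators of record — p11's `𝒟_k = DkE` ((4.4.4), Landau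
minimizers), `∂^* = (curlOp w c)†`, p30's `Q^{e*}_k = QesOp hd w k`, `w = η^d`, `c = η⁻¹`, `η = L^{−k}` — applied to the plaquette field
`f^{(k)} = (ie_k)^{−1} ln v(∂·)` ((4.2.4), branch (2.11): `plaqField e v`) of the unit-lattice `U(1)` field `v`.
[cite: BalabanImbrieJaffe1985, (4.5.4) p.313] -/
def smoothX (hd : 2 ≤ P.d) (k : ℕ) (e : ℝ) (v : U1Field P k) : BondSpace P :=
  DkE P ((P.eta k) ^ P.d) (P.eta k)⁻¹ k (LinearMap.adjoint (curlOp (P := P) ((P.eta k) ^ P.d) (P.eta k)⁻¹)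
    (QesOp (P := P) hd ((P.eta k) ^ P.d) k (toU P k (plaqField e v))))

/-- **THE ACTUAL BACKGROUND FIELD (4.5.4)** computed from the unit-lattice field `v`: `u_k = (Q^{s*}_kv)·exp[−ie_kηX]`, `Q^{s*}_kv` the
group-valued pull-back (4.5.3) (`qsU1Iter k v`), `X = smoothX` — p30's form of the typed (4.5.4) (`background_group_eq_background`).
[cite: BalabanImbrieJaffe1985, (4.5.4) p.313] -/
def actualBg (hd : 2 ≤ P.d) (k : ℕ) (e : ℝ) (v : U1Field P k) : U1Field P 0 :=
  qsU1Iter k v * expField (e * P.eta k) (WithLp.ofLp (-(smoothX hd k e v)))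

/-- **Remark 2 p. 317 for the actual background**: `u_k(∂p) = exp[ie_kη²((Q^{e*}_kf^{(k)})(p) − (∂X)(p))]`, `∂ = curl η⁻¹`, `X = smoothX`
(p31's `plaq_background531_eq_exp` at `B = (ie_k)^{−1} ln v` through p30's `background_group_eq_background`; `k ≤ m + K`, `2 ≤ d`, `e ≠ 0`).
[cite: BalabanImbrieJaffe1985, (5.2.12) p.317] -/
theorem plaq_actualBg_eq_exp (hd : 2 ≤ P.d) {k : ℕ} (hk : k ≤ P.m + P.K) {e : ℝ} (he : e ≠ 0) (v : U1Field P k)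
    (p : Balaban1983to89.Plaq P 0) :
    plaq (actualBg hd k e v) p =
      Circle.exp (e * (P.eta k) ^ 2 * (QestarIter hd k (plaqField e v) p
        - curl (P.eta k)⁻¹ (WithLp.ofLp (smoothX hd k e v)) p)) := by
  have hη := eta_mul_L_pow P k
  have h := plaq_background531_eq_exp hd hk he (P.eta k) hη (bondPotential e v) (WithLp.ofLp (smoothX hd k e v)) p
  rw [expField_bondPotential e he v] at h
  rw [actualBg, background_group_eq_background hk he (P.eta k) hη v (smoothX hd k e v)]
  exact h

/-- **`u_k(∂p) = exp(ie_kη²f_k(p))` with `f_k` THE FIELD (4.2.6)** (Remark 2 + (5.2.10), *"coinciding with (4.2.6)"*): in the Euclidean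
encoding `f_k(p) = (√w)⁻¹·resE(p)`, `w = η^d` (`k ≤ m + K`, `2 ≤ d`, `e ≠ 0`). [cite: BalabanImbrieJaffe1985, (5.2.12) p.317] -/
theorem plaq_actualBg_eq_exp_resE (hd : 2 ≤ P.d) {k : ℕ} (hk : k ≤ P.m + P.K) {e : ℝ} (he : e ≠ 0) (v : U1Field P k)
    (p : Balaban1983to89.Plaq P 0) :
    plaq (actualBg hd k e v) p =
      Circle.exp (e * (P.eta k) ^ 2 * (Real.sqrt ((P.eta k) ^ P.d))⁻¹
        * resE hd ((P.eta k) ^ P.d) (P.eta k)⁻¹ k (toU P k (plaqField e v)) p) := by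
  have hw : 0 < (P.eta k) ^ P.d := pow_pos (eta_pos P k) _
  have hs : Real.sqrt ((P.eta k) ^ P.d) ≠ 0 := (Real.sqrt_pos.2 hw).ne'
  rw [plaq_actualBg_eq_exp hd hk he v p, resE_apply hd hk (inv_ne_zero (eta_pos P k).ne') hw]
  congr 1
  have e1 : (fun q => (toU P k (plaqField e v)) q) = plaqField e v := rfl
  rw [e1, mul_assoc (e * P.eta k ^ 2), inv_mul_cancel_left₀ hs]
  rfl

/-- **`|u_k(∂p) − 1| ≤ |e_k|η²·|f_k(p)|`** for every η-plaquette `p` — `|e^{it} − 1| ≤ |t|` at the exponent of `plaq_actualBg_eq_exp_resE`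
(`k ≤ m + K`, `2 ≤ d`, `e ≠ 0`). [cite: BalabanImbrieJaffe1985, (5.2.12) p.317] -/
theorem norm_plaq_actualBg_sub_one_le (hd : 2 ≤ P.d) {k : ℕ} (hk : k ≤ P.m + P.K) {e : ℝ} (he : e ≠ 0) (v : U1Field P k)
    (p : Balaban1983to89.Plaq P 0) :
    ‖((plaq (actualBg hd k e v) p : Circle) : ℂ) - 1‖ ≤
      |e| * (P.eta k) ^ 2 * (Real.sqrt ((P.eta k) ^ P.d))⁻¹
        * |resE hd ((P.eta k) ^ P.d) (P.eta k)⁻¹ k (toU P k (plaqField e v)) p| := by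
  rw [plaq_actualBg_eq_exp_resE hd hk he v p, Circle.coe_exp]
  set t : ℝ := e * (P.eta k) ^ 2 * (Real.sqrt ((P.eta k) ^ P.d))⁻¹
    * resE hd ((P.eta k) ^ P.d) (P.eta k)⁻¹ k (toU P k (plaqField e v)) p with ht
  have h := (Real.norm_exp_I_mul_ofReal_sub_one_le (x := t))
  rw [mul_comm Complex.I] at h
  refine h.trans (le_of_eq ?_)
  rw [ht, Real.norm_eq_abs, abs_mul, abs_mul, abs_mul, abs_of_pos (pow_pos (eta_pos P k) 2),
    abs_of_pos (inv_pos.2 (Real.sqrt_pos.2 (pow_pos (eta_pos P k) _)))]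

/-! ## §3 The background on the `U1`-valued carrier of the scalar-field files, all orientations -/

/-- the actual background (4.5.4) read on the `U1 = U(1) ⊂ M₁(ℂ)`-valued carrier `GaugeField P 0 U1` of the Sect. 4.6 / 7.3 scalar-field
files (p34's configuration dictionary `fieldEquiv`). [cite: BalabanImbrieJaffe1985, (4.5.4) p.313] -/
def actualBgU1 (hd : 2 ≤ P.d) (k : ℕ) (e : ℝ) (v : U1Field P k) : GaugeField P 0 U1 :=
  fieldEquiv (actualBg hd k e v)

/-- kernel: plaquette variables commute with the carrier dictionary, `(fieldEquiv u)(∂p) = u(∂p)` read in `ℂ` (r18's `plaqVar_coe`,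
p34's `cfg_fieldEquiv`, `plaqVar_cfg`). [cite: BalabanImbrieJaffe1985, (2.5) p.302] -/
theorem toC_plaqHol_fieldEquiv {j : ℕ} (u : U1Field P j) (p : Balaban1983to89.Plaq P j) :
    toC (GaugeField.plaqHol (fieldEquiv u) p) = ((plaq u p : Circle) : ℂ) := by
  rw [← plaqVar_cfg, cfg_fieldEquiv, plaqVar_coe]

/-- **ALL ORIENTED PLAQUETTE VARIABLES OF `u_k` ARE WITHIN `|e_k|η²(√w)⁻¹·S` OF `1`** whenever `|resE(p)| ≤ S` for every η-plaquette
(`S ≥ 0`): the hypothesis `hθ` of p11's `BIJ85Ineq732General.ineq732_general` AT THE ACTUAL BACKGROUND, with `θ = |e_k|η²·(sup|f_k|)`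
(`k ≤ m + K`, `2 ≤ d`, `e ≠ 0`). [cite: BalabanImbrieJaffe1985, (7.3.1) p.326] -/
theorem norm_plaqC_actualBgU1_sub_one_le (hd : 2 ≤ P.d) {k : ℕ} (hk : k ≤ P.m + P.K) {e : ℝ} (he : e ≠ 0) (v : U1Field P k)
    {S : ℝ} (hS : 0 ≤ S) (hres : ∀ p : Balaban1983to89.Plaq P 0, |resE hd ((P.eta k) ^ P.d) (P.eta k)⁻¹ k (toU P k (plaqField e v)) p| ≤ S)
    (x : Balaban1983to89.Site P 0) (μ ν : Fin P.d) :
    ‖plaqC (actualBgU1 hd k e v) x μ ν - 1‖ ≤ |e| * (P.eta k) ^ 2 * (Real.sqrt ((P.eta k) ^ P.d))⁻¹ * S := by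
  have hc : 0 ≤ |e| * (P.eta k) ^ 2 * (Real.sqrt ((P.eta k) ^ P.d))⁻¹ := by
    have := (eta_pos P k).le
    positivity
  refine norm_plaqC_sub_one_le_of_plaqHol _ (mul_nonneg hc hS) (fun p => ?_) x μ ν
  rw [actualBgU1, toC_plaqHol_fieldEquiv]
  exact (norm_plaq_actualBg_sub_one_le hd hk he v p).trans (mul_le_mul_of_nonneg_left (hres p) hc)

end

end Literature.MathematicalPhysics.QuantumFieldTheory.BalabanImbrieJaffe1984to88.BIJ85Eq454PlaqResidual
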